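import Summits.AtomisticToContinuum.HydrodynamicLimit.Theses.LindebergRandomFuture
import Summits.AtomisticToContinuum.HydrodynamicLimit.Theorems.LambertianContactSwapLambertianEulerOfHearts
import Summits.AtomisticToContinuum.HydrodynamicLimit.Theses.LambertianContactSwap
import Summits.AtomisticToContinuum.HydrodynamicLimit.Theorems.LambertianContactSwapLambertianEulerArchimedes
import Summits.AtomisticToContinuum.HydrodynamicLimit.Theorems.LambertianContactSwapLambertianEulerLambertLaw
import Summits.AtomisticToContinuum.HydrodynamicLimit.Theorems.LambertianContactSwapLambertianEulerPovzner
import Summits.AtomisticToContinuum.HydrodynamicLimit.Theorems.LambertianContactSwapLambertianEulerPairPovzner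
import Summits.AtomisticToContinuum.HydrodynamicLimit.Theorems.LambertianContactSwapLambertianEulerContactIsotropy
import Summits.AtomisticToContinuum.HydrodynamicLimit.Theorems.LambertianContactSwapLambertianEulerMomentLedgerChain
import Summits.AtomisticToContinuum.HydrodynamicLimit.Theorems.LambertianContactSwapLambertianEulerGibbsInvariance
import Summits.AtomisticToContinuum.HydrodynamicLimit.Theorems.LambertianContactSwapLambertianEulerEntropyToHydro
import Summits.AtomisticToContinuum.HydrodynamicLimit.Theorems.LambertianContactSwapLambertianEulerWindow
import Summits.AtomisticToContinuum.HydrodynamicLimit.Theorems.LambertianContactSwapLambertianEulerMarkov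
import Summits.AtomisticToContinuum.HydrodynamicLimit.Theorems.LambertianContactSwapLambertianEulerIterate
import Summits.AtomisticToContinuum.HydrodynamicLimit.Theorems.LambertianContactSwapLambertianEulerDock
import Summits.AtomisticToContinuum.HydrodynamicLimit.Theorems.LambertianContactSwapLambertianEulerKlLedger
import Summits.AtomisticToContinuum.HydrodynamicLimit.Theorems.LambertianContactSwapLambertianEulerLawSemigroup
import Summits.AtomisticToContinuum.HydrodynamicLimit.Theorems.LambertianContactSwapLambertianEulerDockRf
import Summits.AtomisticToContinuum.HydrodynamicLimit.Theorems.LambertianContactSwapLambertianEulerLambertDirMean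
import Summits.AtomisticToContinuum.HydrodynamicLimit.Theorems.LambertianContactSwapLambertianEulerPairMeanSq
import Summits.AtomisticToContinuum.HydrodynamicLimit.Theorems.LambertianContactSwapLambertianEulerPathwiseProduction
import Summits.AtomisticToContinuum.HydrodynamicLimit.Theorems.LambertianContactSwapLambertianEulerWindowLedger
import Summits.AtomisticToContinuum.HydrodynamicLimit.Theorems.LambertianContactSwapLambertianEulerCollisionCompensator
import Summits.AtomisticToContinuum.HydrodynamicLimit.Theorems.LambertianContactSwapLambertianEulerCompensatedJump
import Summits.AtomisticToContinuum.HydrodynamicLimit.Theorems.LambertianContactSwapLambertianEulerAprioriEntropyBound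
import Summits.AtomisticToContinuum.HydrodynamicLimit.Theorems.LambertianContactSwapLambertianEulerCollisionIntensity
import Summits.AtomisticToContinuum.HydrodynamicLimit.Theorems.LambertianContactSwapLambertianEulerTwoTimeLaw
import Summits.AtomisticToContinuum.HydrodynamicLimit.Theorems.LambertianContactSwapLambertianEulerCollisionBudget
import Summits.AtomisticToContinuum.HydrodynamicLimit.Theorems.LambertianContactSwapLambertianEulerExpectedWindowProductionTools
import Summits.AtomisticToContinuum.HydrodynamicLimit.Theorems.LambertianContactSwapLambertianEulerExpectedWindowProduction
import Summits.AtomisticToContinuum.HydrodynamicLimit.Theorems.LambertianContactSwapLambertianEulerProductionSplit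
import Summits.AtomisticToContinuum.HydrodynamicLimit.Theorems.TwoClocksClampedEntropyClockTimeZeroReference
import Summits.AtomisticToContinuum.HydrodynamicLimit.Theorems.TwoClocksClampedEntropyClockDiscreteEntropyGronwall
import Summits.AtomisticToContinuum.HydrodynamicLimit.Theorems.TwoClocksClampedEntropyClockKlDivLawAtLocalGibbsNeTop
import Literature.MathematicalPhysics.KineticTheory.LambertianRedrawNondegenerate
import Literature.MathematicalPhysics.KineticTheory.Hilbert6Wave0Proofs
import Literature.MathematicalPhysics.KineticTheory.HardSphereEulerLLN
import Literature.Barriers.AtomisticToContinuum.HighMomentumCutoff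
import Literature.Analysis.FluidPDE.HardSphereAlexander
import HarnessLib

/-! TTRL-lite variant V12792 of stmt-AtomisticToContinuum-11854 -/

namespace Summit.AtomisticToContinuum.HydrodynamicLimit.Theorems

open scoped BigOperators Topology ENNReal InnerProductSpace
open MeasureTheory ProbabilityTheory Filter Set InformationTheory
open Literature.MathematicalPhysics.KineticTheory
open Literature.Analysis.FluidPDE Literature.Analysis.FluidPDE.Alexander
open Summit.AtomisticToContinuum.HydrodynamicLimit.Theses.LambertianContactSwap
open Summit.AtomisticToContinuum.HydrodynamicLimit.Theorems.ClampedCurrentsDockPathwise (gSum DgSum)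

/-- **Mass normalisation forced by the tie at time 0.** If the local-Gibbs empirical fields at
time `0` converge in probability to `(ρ, ρu, E)(0)`, then `∫ ρ 0 = 1`: test `χ ≡ 1` — the empirical
density of `1` is identically `1` (`empiricalDensityField_one`) and the local Gibbs laws are
probability measures for `σ ≤ 1/2` (`isProbabilityMeasure_localGibbsLaw`), so a deviation
`|1 - ∫ρ 0| > 0` would be a probability-one event whose probability tends to `0`.
TTRL-lite variant V12792 of `stub_diluteSelfConsistency` (stmt-AtomisticToContinuum-11854). -/
theorem stub_diluteSelfConsistency_var12792 :
    ∀ σ : ℝ, 0 < σ → σ ≤ 1 / 2 → ∀ (a₀ θ₀ : T3 → ℝ) (u₀ : T3 → V3), Continuous a₀ → Continuous θ₀ → Continuous u₀ → (∀ x, 0 < a₀ x) → (∀ x, 0 < θ₀ x) → ∀ (ρ θ : ℝ → T3 → ℝ) (u : ℝ → T3 → V3) (Φ : (N : ℕ) → HardSphereFlow (Torus.geometry (Fin 3)) (hsDiameter σ N) (N + 1)), TendstoHydroFieldsAt (fun N => localGibbsLaw σ a₀ u₀ θ₀ N (Φ N)) Φ ρ u θ 0 → ∫ x, ρ 0 x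 = 1 := by
  intro σ _hσ hσ2 a₀ θ₀ u₀ ha hθ hu ha0 hθ0 ρ θ u Φ hconv
  by_contra hne
  have habs : 0 < |1 - ∫ x, ρ 0 x| := abs_pos.mpr (sub_ne_zero.mpr (Ne.symm hne))
  obtain ⟨h1, -, -⟩ := hconv (fun _ => (1 : ℝ)) continuous_const (|1 - ∫ x, ρ 0 x| / 2) (half_pos habs)
  have hconst : ∀ N : ℕ, localGibbsLaw σ a₀ u₀ θ₀ N (Φ N)
      {z | |1 - ∫ x, ρ 0 x| / 2 <
        |empiricalDensityField ((Φ N).flow 0 z) (fun _ => 1) - ∫ x, (fun _ => (1 : ℝ)) x * ρ 0 x|} = 1 := by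
    intro N
    haveI := isProbabilityMeasure_localGibbsLaw (u₀ := u₀) ha hθ hu ha0 hθ0 hσ2 N (Φ N)
    have hset : {z : Literature.Analysis.FluidPDE.Config (N + 1) (Fin 3) T3 | |1 - ∫ x, ρ 0 x| / 2 <
          |empiricalDensityField ((Φ N).flow 0 z) (fun _ => 1) - ∫ x, (fun _ => (1 : ℝ)) x * ρ 0 x|} =
        Set.univ := by
      refine Set.eq_univ_of_forall fun z => ?_
      simp only [Set.mem_setOf_eq, one_mul, empiricalDensityField_one (Nat.succ_ne_zero N)]
      exact half_lt_self habs
    rw [hset, measure_univ]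
  have h2 : Filter.Tendsto (fun _ : ℕ => (1 : ENNReal)) Filter.atTop (nhds 0) :=
    h1.congr' (Filter.Eventually.of_forall hconst)
  exact one_ne_zero (tendsto_nhds_unique tendsto_const_nhds h2)

end Summit.AtomisticToContinuum.HydrodynamicLimit.Theorems
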